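import Literature.MathematicalPhysics.QuantumLattice.XYZGroundStateOrderSpinHalfHolds
import Literature.MathematicalPhysics.QuantumLattice.HeisenbergOrderNeelShortRange
import Literature.MathematicalPhysics.QuantumLattice.StructureFactorSumRuleFloor
import HarnessLib

/-!
# The dictionary (trial-kernel) Kennedy–Lieb–Shastry bound for the ground state of the XYZ / easy-
# plane XXZ model, with certified correlation windows

Topic `MathematicalPhysics/QuantumLattice` (family `hubbard`). Sibling of `XYZGroundStateOrderProofs.lean`
(Björnberg–Ueltschi's finite-volume assembly for `H' = anisotropicTorus d L n 1 J₂ J₁`: structure factor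
`ĝ⁰_q = xyzStructureFactor`, sum rule, and the `T = 0` infrared bound from Gaussian domination
`xyz_infraredBound_of_groundEnergy_le`) and the XYZ analogue of `HeisenbergOrderNeelKernelSumRule.lean`
(which does the same for the Heisenberg ANTIferromagnet). The B–U / Kubo–Kishi closure uses ONE kernel
(total sum rule + nearest-neighbour energy); Kennedy–Lieb–Shastry's method allows an ARBITRARY real
dictionary `κ` of shift weights, and with certified two-sided windows on finitely many correlations the
optimal dictionary is the dual solution of a linear programme. This file proves, for every dictionary:

* `sum_xyzStructureFactor_mul_cos_torusPhase` — the shift-`z` sum rule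
  `Σ_q ĝ⁰_q cos(p_q·z) = Σ_x G⁰(x, x+z)` (character orthogonality; `G⁰ = xyzGroundCorr 0`, the tracial
  ground-state two-point function of the first component), and its dictionary form
  `sum_xyzStructureFactor_mul_dictionary`;
* `xyzStructureFactor_nonneg` — `ĝ⁰_q ≥ 0` at EVERY `q` (positivity of the state; no Gaussian domination);
* `xyzStructureFactor_le_sqrt_of_groundEnergy_le` — the infrared bound as a ceiling
  `ĝ⁰_q ≤ √(X_q/(4E_q))`, `q ≠ 0`, `X_q = Σᵢ(α' - β' cos qᵢ)`, `α' = J₂c¹ + J₁c²`, `β' = J₁c¹ + J₂c²`,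
  `E_q = Σᵢ(1 - cos qᵢ)`, under the Gaussian-domination hypothesis of `xyz_infraredBound_of_groundEnergy_le`;
* `xyz_dictionary_floor_of_groundEnergy_le` — **the dictionary bound**: for every `κ : Λ → ℝ`,
  `Σ_z κ(z) Σ_x G⁰(x,x+z) - Σ_{q ≠ 0} K(q)⁺ √(X_q/(4E_q)) ≤ K(0) · ĝ⁰_0`, `K(q) = Σ_z κ(z) cos(p_q·z)`,
  `K(0) = Σ_z κ(z)` (the `k = 0` bookkeeping is `sub_sum_erase_le_kernel_mul_of_ceilings` of
  `StructureFactorSumRuleFloor.lean`); `xyz_dictionary_floor` discharges Gaussian domination on even tori of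
  side `≥ 4` for `0 ≤ J₁`, `J₂ ≤ 0`, every spin (`buSpinHalf_gaussianDomination`);
* `xyz_lpDual_floor_of_groundEnergy_le` / `xyz_lpDual_floor` — **the certified-window form**: two-sided
  windows `|L⁻ᵈ Σ_x G⁰(x,x+z) - c_z| ≤ ε_z` on a finite set `W` of shifts, certified uppers `X_q ≤ X̄_q`
  (`q ≠ 0`, from windows on `c¹, c²`), and ANY weights `κ` on `W`:
  `Σ_{z∈W}(κ_z c_z - |κ_z| ε_z) - L⁻ᵈ Σ_{q≠0} K(q)⁺ √(X̄_q/(4E_q)) ≤ K(0) · L⁻ᵈ ĝ⁰_0`, where `L⁻ᵈ ĝ⁰_0` is the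
  long-range-order sequence of `xxz_ground_lro_spinHalf_window` (`xyz_lroSeq_eq`).

* `xyz_hasEvenTorusLRO_of_lpDual_certificate` — PACKAGING: an eventual (in even `L`) LP-dual certificate
  with an `L`-independent margin `a > 0` gives `HasEvenTorusLRO (groundStateAxisCorrTorus · n J₁ J₂ 1)`, the
  conclusion shape of `xxz_ground_lro_spinHalf_window`.

HONEST FRAMING. These are `L`-by-`L` inequalities; an `L`-UNIFORM floor needs an `L`-uniform majorant of
the punctured Riemann sum `L⁻ᵈ Σ_{q≠0} K(q)⁺ √(X̄_q/(4E_q))` (trigonometric-polynomial majorants, the method of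
`HeisenbergOrderNeelWindowDictionary.lean`), which stays symbolic here, and CERTIFIED correlation windows,
which no seat holds today for this model. Use: (i) the typed form of the "proposed engine" of the crux
`PbHalfFilledXYOrder` of route `HubbardSuperconductivity/PlaquetteBoson` (easy-plane XXZ order on the whole
interval; in print only `|Δ| ≲ 0.2`: Kubo–Kishi 1988, Wischmann–Müller-Hartmann 1991; tree
`xxz_ground_lro_spinHalf_window`: `Δ ≤ 0.15`) in the TRACIAL ground-state vocabulary — the sector form of
that crux needs in addition the identification of the sector ground state (cf.
`Summits/…/Theorems/AnisotropyChordSectorAnchorXY*.lean` at `Δ = 0`), not done here; (ii) the explicit XXZ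
dictionary asked for by the hubbard-cq transfer lens. Calibration [float, kit job j255957, linear-spin-wave
proxy correlators in place of certified ones, `d = 2`, `L = 64`, spin ½, window = all shifts of `ℓ∞`-range
`R` to precision `ε`]: anisotropy `-J₂ = 0.5`, `ε = 10⁻³`: LP floor `0.045` (R = 2) → `0.074` (R = 8) vs proxy
order `0.083`; `-J₂ = 0.9`, `ε = 10⁻³`: `0.019` → `0.054` vs `0.065`; `-J₂ = 0.99`, `ε = 3·10⁻³`: `0.002` →
`0.039` vs `0.053`; the single nearest-neighbour kernel gives `0` from `-J₂ ≈ 0.9` on.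

No definition and no named fact is introduced; every declaration is a proved theorem.

## References
* T. Kennedy, E. H. Lieb, B. S. Shastry, J. Stat. Phys. 53 (1988) 1019–1030 [KLS1988JSP], eqs. (1)–(3),
  (6)–(11), p. 1021 (the trial-kernel method).
* J. E. Björnberg, D. Ueltschi, *Reflection positivity and infrared bounds for quantum spin systems*,
  Lecture Notes in Math. 2308 (2022) 77–108 [BjornbergUeltschi2022], Lemma 4.4, Thm. 3.2, (4.23)–(4.38).
* K. Kubo, T. Kishi, Phys. Rev. Lett. 61 (1988) 2585 [KuboKishi1988] (the spin-½ XXZ window).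
* H.-A. Wischmann, E. Müller-Hartmann, J. Phys. I France 1 (1991) 647 [WischmannMullerhartmann1991], §5.
-/

noncomputable section

open Matrix Finset Filter Topology
open scoped ComplexOrder
open Literature.MathematicalPhysics.QuantumLattice Literature.MathematicalPhysics.QuantumLattice.SpinOperators
  Literature.Probability.LatticeModels

namespace Literature.MathematicalPhysics.QuantumLattice

variable {d : ℕ}

section Dictionary

variable (L : ℕ) [NeZero L] (n : ℕ) (J₁ J₂ : ℝ)

/-! ### The shift sum rule and positivity -/

/-- **The shift-`z` sum rule** for the tracial ground state of `H' = anisotropicTorus d L n 1 J₂ J₁`: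
`Σ_q ĝ⁰_q cos(p_q·z) = Σ_x G⁰(x, x+z)` for every shift `z` of the torus (character orthogonality,
`sum_structureFactor_mul_cos_torusPhase`; `z = eᵢ` summed over `i` is B–U's (4.38) / the tree's
`xyz_structureFactor_sumRule`). [cite: KLS1988JSP, eqs. (3), (10)-(11)] [cite: BjornbergUeltschi2022, eq. (4.38)] -/
theorem sum_xyzStructureFactor_mul_cos_torusPhase (z : TorusSite d L) :
    ∑ q : TorusSite d L, xyzStructureFactor L n J₁ J₂ q * Real.cos (torusPhase L q z) =
      ∑ x : TorusSite d L, xyzGroundCorr 0 L n J₁ J₂ x (x + z) := by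
  have hLd : (L : ℝ) ^ d ≠ 0 := by
    have : (L : ℝ) ≠ 0 := by exact_mod_cast NeZero.ne L
    positivity
  simp_rw [xyzStructureFactor_of_neZero, div_mul_eq_mul_div, ← Finset.sum_div]
  rw [sum_structureFactor_mul_cos_torusPhase L (xyzGroundCorr 0 L n J₁ J₂)
    (xyzGroundCorr_symm L n J₁ J₂ 0) z, mul_div_cancel_left₀ _ hLd]

/-- **The dictionary sum rule**: for every real weight `κ` on shifts,
`Σ_q ĝ⁰_q (Σ_z κ(z) cos(p_q·z)) = Σ_z κ(z) Σ_x G⁰(x, x+z)`. [cite: KLS1988JSP, eqs. (2)-(3), p. 1021] -/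
theorem sum_xyzStructureFactor_mul_dictionary (κ : TorusSite d L → ℝ) :
    ∑ q : TorusSite d L, xyzStructureFactor L n J₁ J₂ q *
        (∑ z : TorusSite d L, κ z * Real.cos (torusPhase L q z)) =
      ∑ z : TorusSite d L, κ z * ∑ x : TorusSite d L, xyzGroundCorr 0 L n J₁ J₂ x (x + z) := by
  calc ∑ q : TorusSite d L, xyzStructureFactor L n J₁ J₂ q *
        (∑ z : TorusSite d L, κ z * Real.cos (torusPhase L q z))
      = ∑ z : TorusSite d L, κ z *
          ∑ q : TorusSite d L, xyzStructureFactor L n J₁ J₂ q * Real.cos (torusPhase L q z) := by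
        simp_rw [mul_sum]
        rw [sum_comm]
        refine sum_congr rfl fun z _ => sum_congr rfl fun q _ => ?_
        ring
    _ = ∑ z : TorusSite d L, κ z * ∑ x : TorusSite d L, xyzGroundCorr 0 L n J₁ J₂ x (x + z) := by
        refine sum_congr rfl fun z _ => ?_
        rw [sum_xyzStructureFactor_mul_cos_torusPhase]

/-- **`ĝ⁰_q ≥ 0` at every momentum** (positivity of the tracial ground state on `C_q²` and `D_q²`,
`xyzStructureFactor_eq_modes`; no Gaussian domination is used). [cite: BjornbergUeltschi2022, eq. (4.23)] -/
theorem xyzStructureFactor_nonneg (q : TorusSite d L) : 0 ≤ xyzStructureFactor L n J₁ J₂ q := by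
  have hLd : (0 : ℝ) < (L : ℝ) ^ d := by
    have : (0 : ℝ) < L := by exact_mod_cast Nat.pos_of_ne_zero (NeZero.ne L)
    positivity
  have h0 : 0 ≤ xyzStructureFactor L n J₁ J₂ q * (L : ℝ) ^ d := by
    rw [xyzStructureFactor_eq_modes]
    exact add_nonneg
      (re_groundStateFunctional_mul_self_nonneg _ (xyCosMode_isHermitian L n q))
      (re_groundStateFunctional_mul_self_nonneg _ (xySinMode_isHermitian L n q))
  exact nonneg_of_mul_nonneg_left h0 hLd

/-! ### The infrared bound as a ceiling -/

/-- **The infrared ceiling** at `q ≠ 0` (`L ≥ 3`, `d ≥ 1`, Gaussian domination assumed):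
`ĝ⁰_q ≤ √(X_q/(4E_q))`, `X_q = Σᵢ(α' - β' cos qᵢ)`, `E_q = Σᵢ(1 - cos qᵢ)` — the square root of
`xyz_infraredBound_of_groundEnergy_le`. [cite: BjornbergUeltschi2022, Lemma 4.4] [cite: KLS1988JSP, eq. (1)] -/
theorem xyzStructureFactor_le_sqrt_of_groundEnergy_le (hL : 3 ≤ L) (hd : 0 < d)
    (hGD : ∀ h : TorusSite d L → ℝ,
      (anisotropicTorus d L n 1 J₂ J₁).groundEnergy ≤
        (anisotropicTorus d L n 1 J₂ J₁ - (2 : ℂ) • xyGradField L n h +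
          ((xyFieldEnergy L h : ℝ) : ℂ) • 1).groundEnergy)
    (q : TorusSite d L) (hq : q ≠ 0) :
    xyzStructureFactor L n J₁ J₂ q ≤
      Real.sqrt ((∑ i, ((J₂ * xyzBondCorr (d := d) 1 L n J₁ J₂ + J₁ * xyzBondCorr (d := d) 2 L n J₁ J₂) -
          (J₁ * xyzBondCorr (d := d) 1 L n J₁ J₂ + J₂ * xyzBondCorr (d := d) 2 L n J₁ J₂) *
            Real.cos (latticeMomentum L q i))) / (4 * dispersion (latticeMomentum L q))) := by
  obtain ⟨hg0, hIR⟩ := xyz_infraredBound_of_groundEnergy_le L n J₁ J₂ hL hd hGD q hq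
  have hE : 0 < dispersion (latticeMomentum L q) := dispersion_latticeMomentum_pos hq
  have h2 : xyzStructureFactor L n J₁ J₂ q ^ 2 ≤
      (∑ i, ((J₂ * xyzBondCorr (d := d) 1 L n J₁ J₂ + J₁ * xyzBondCorr (d := d) 2 L n J₁ J₂) -
          (J₁ * xyzBondCorr (d := d) 1 L n J₁ J₂ + J₂ * xyzBondCorr (d := d) 2 L n J₁ J₂) *
            Real.cos (latticeMomentum L q i))) / (4 * dispersion (latticeMomentum L q)) := by
    rw [le_div_iff₀ (by positivity)]
    linarith
  rw [← Real.sqrt_sq hg0]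
  exact Real.sqrt_le_sqrt h2

/-! ### The dictionary bound -/

/-- **The dictionary Kennedy–Lieb–Shastry bound in finite volume** (Gaussian domination assumed,
`L ≥ 3`, `d ≥ 1`, every spin): for every real weight `κ` on the shifts of the torus,
`Σ_z κ(z) Σ_x G⁰(x,x+z) - Σ_{q ≠ 0} K(q)⁺ √(X_q/(4E_q)) ≤ (Σ_z κ(z)) · ĝ⁰_0`, `K(q) = Σ_z κ(z) cos(p_q·z)`:
the dictionary sum rule, the split `q = 0` / `q ≠ 0`, positivity of `ĝ⁰` to drop the negative part of the
kernel, and the infrared ceiling on the positive part. [cite: KLS1988JSP, eqs. (1)-(3), (6)-(11)]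
[cite: BjornbergUeltschi2022, Lemma 4.4 and (4.38)] -/
theorem xyz_dictionary_floor_of_groundEnergy_le (hL : 3 ≤ L) (hd : 0 < d)
    (hGD : ∀ h : TorusSite d L → ℝ,
      (anisotropicTorus d L n 1 J₂ J₁).groundEnergy ≤
        (anisotropicTorus d L n 1 J₂ J₁ - (2 : ℂ) • xyGradField L n h +
          ((xyFieldEnergy L h : ℝ) : ℂ) • 1).groundEnergy)
    (κ : TorusSite d L → ℝ) :
    (∑ z : TorusSite d L, κ z * ∑ x : TorusSite d L, xyzGroundCorr 0 L n J₁ J₂ x (x + z)) -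
        ∑ q ∈ (univ : Finset (TorusSite d L)).erase 0,
          max (∑ z : TorusSite d L, κ z * Real.cos (torusPhase L q z)) 0 *
            Real.sqrt ((∑ i, ((J₂ * xyzBondCorr (d := d) 1 L n J₁ J₂ + J₁ * xyzBondCorr (d := d) 2 L n J₁ J₂) -
              (J₁ * xyzBondCorr (d := d) 1 L n J₁ J₂ + J₂ * xyzBondCorr (d := d) 2 L n J₁ J₂) *
                Real.cos (latticeMomentum L q i))) / (4 * dispersion (latticeMomentum L q))) ≤
      (∑ z : TorusSite d L, κ z) * xyzStructureFactor L n J₁ J₂ (0 : TorusSite d L) := by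
  have h := sub_sum_erase_le_kernel_mul_of_ceilings (xyzStructureFactor L n J₁ J₂)
    (fun q => Real.sqrt ((∑ i, ((J₂ * xyzBondCorr (d := d) 1 L n J₁ J₂ + J₁ * xyzBondCorr (d := d) 2 L n J₁ J₂) -
      (J₁ * xyzBondCorr (d := d) 1 L n J₁ J₂ + J₂ * xyzBondCorr (d := d) 2 L n J₁ J₂) *
        Real.cos (latticeMomentum L q i))) / (4 * dispersion (latticeMomentum L q))))
    (fun q => ∑ z : TorusSite d L, κ z * Real.cos (torusPhase L q z)) 0
    (Φ := ∑ z : TorusSite d L, κ z * ∑ x : TorusSite d L, xyzGroundCorr 0 L n J₁ J₂ x (x + z))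
    (xyzStructureFactor_nonneg L n J₁ J₂)
    (by
      rw [← sum_xyzStructureFactor_mul_dictionary]
      exact le_of_eq (sum_congr rfl fun q _ => mul_comm _ _))
    (fun q hq => xyzStructureFactor_le_sqrt_of_groundEnergy_le L n J₁ J₂ hL hd hGD q hq)
  simpa only [torusPhase_zero_left, Real.cos_zero, mul_one] using h

/-- **The dictionary bound, Gaussian domination discharged**: on an even torus of side `L ≥ 4`, for
`0 ≤ J₁`, `J₂ ≤ 0`, `d ≥ 1`, every spin `n/2` and every dictionary `κ`, the inequality of
`xyz_dictionary_floor_of_groundEnergy_le` holds (B–U Cor. 5.3, tree `buSpinHalf_gaussianDomination`).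
[cite: BjornbergUeltschi2022, Cor. 5.3, Lemma 4.4] [cite: KLS1988JSP, eqs. (6)-(11)] -/
theorem xyz_dictionary_floor (hLe : Even L) (h4 : 4 ≤ L) (hd : 0 < d) (hJ₁ : 0 ≤ J₁) (hJ₂ : J₂ ≤ 0)
    (κ : TorusSite d L → ℝ) :
    (∑ z : TorusSite d L, κ z * ∑ x : TorusSite d L, xyzGroundCorr 0 L n J₁ J₂ x (x + z)) -
        ∑ q ∈ (univ : Finset (TorusSite d L)).erase 0,
          max (∑ z : TorusSite d L, κ z * Real.cos (torusPhase L q z)) 0 *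
            Real.sqrt ((∑ i, ((J₂ * xyzBondCorr (d := d) 1 L n J₁ J₂ + J₁ * xyzBondCorr (d := d) 2 L n J₁ J₂) -
              (J₁ * xyzBondCorr (d := d) 1 L n J₁ J₂ + J₂ * xyzBondCorr (d := d) 2 L n J₁ J₂) *
                Real.cos (latticeMomentum L q i))) / (4 * dispersion (latticeMomentum L q))) ≤
      (∑ z : TorusSite d L, κ z) * xyzStructureFactor L n J₁ J₂ (0 : TorusSite d L) :=
  xyz_dictionary_floor_of_groundEnergy_le L n J₁ J₂ (by omega) hd
    (fun h => buSpinHalf_gaussianDomination L n hLe h4 hJ₁ hJ₂ h) κ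

/-! ### The certified-window (LP-dual) form -/

/-- **The LP-dual bound with certified correlation windows** (Gaussian domination assumed, `L ≥ 3`,
`d ≥ 1`). Data: a finite set `W` of shifts with certified two-sided windows
`|L⁻ᵈ Σ_x G⁰(x,x+z) - c_z| ≤ ε_z` on the site-averaged first-component correlations, and certified upper
bounds `X_q ≤ X̄_q` (`q ≠ 0`) on the infrared numerators; certificate: ANY real weights `κ` on `W`. Then,
with `K(q) = Σ_{z∈W} κ_z cos(p_q·z)`,
`Σ_{z∈W}(κ_z c_z - |κ_z| ε_z) - Σ_{q≠0} K(q)⁺ · L⁻ᵈ√(X̄_q/(4E_q)) ≤ K(0) · L⁻ᵈ ĝ⁰_0` — weak duality of the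
dictionary infrared LP (`lpDual_kernel_floor`); `L⁻ᵈ ĝ⁰_0` is the long-range-order sequence (`xyz_lroSeq_eq`).
[cite: KLS1988JSP, eqs. (1)-(3), (6)-(11), p. 1021] [cite: BjornbergUeltschi2022, Lemma 4.4] -/
theorem xyz_lpDual_floor_of_groundEnergy_le (hL : 3 ≤ L) (hd : 0 < d)
    (hGD : ∀ h : TorusSite d L → ℝ,
      (anisotropicTorus d L n 1 J₂ J₁).groundEnergy ≤
        (anisotropicTorus d L n 1 J₂ J₁ - (2 : ℂ) • xyGradField L n h +
          ((xyFieldEnergy L h : ℝ) : ℂ) • 1).groundEnergy)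
    (W : Finset (TorusSite d L)) (κ c ε : TorusSite d L → ℝ) (Xup : TorusSite d L → ℝ)
    (hrow : ∀ z ∈ W,
      |(∑ x : TorusSite d L, xyzGroundCorr 0 L n J₁ J₂ x (x + z)) / (L : ℝ) ^ d - c z| ≤ ε z)
    (hX : ∀ q : TorusSite d L, q ≠ 0 →
      (∑ i, ((J₂ * xyzBondCorr (d := d) 1 L n J₁ J₂ + J₁ * xyzBondCorr (d := d) 2 L n J₁ J₂) -
          (J₁ * xyzBondCorr (d := d) 1 L n J₁ J₂ + J₂ * xyzBondCorr (d := d) 2 L n J₁ J₂) *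
            Real.cos (latticeMomentum L q i))) ≤ Xup q) :
    ∑ z ∈ W, (κ z * c z - |κ z| * ε z) -
        ∑ q ∈ (univ : Finset (TorusSite d L)).erase 0,
          max (∑ z ∈ W, κ z * Real.cos (torusPhase L q z)) 0 *
            (Real.sqrt (Xup q / (4 * dispersion (latticeMomentum L q))) / (L : ℝ) ^ d) ≤
      (∑ z ∈ W, κ z) * (xyzStructureFactor L n J₁ J₂ (0 : TorusSite d L) / (L : ℝ) ^ d) := by
  have hLd : (0 : ℝ) < (L : ℝ) ^ d := by
    have : (0 : ℝ) < L := by exact_mod_cast Nat.pos_of_ne_zero (NeZero.ne L)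
    positivity
  -- the mode function `S_q = L⁻ᵈ ĝ⁰_q`, its rows and ceilings
  have hS : ∀ q : TorusSite d L, 0 ≤ xyzStructureFactor L n J₁ J₂ q / (L : ℝ) ^ d := fun q =>
    div_nonneg (xyzStructureFactor_nonneg L n J₁ J₂ q) hLd.le
  have hrow' : ∀ z ∈ W, |∑ q : TorusSite d L, Real.cos (torusPhase L q z) *
      (xyzStructureFactor L n J₁ J₂ q / (L : ℝ) ^ d) - c z| ≤ ε z := by
    intro z hz
    have h1 : ∑ q : TorusSite d L, Real.cos (torusPhase L q z) *
        (xyzStructureFactor L n J₁ J₂ q / (L : ℝ) ^ d) =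
        (∑ x : TorusSite d L, xyzGroundCorr 0 L n J₁ J₂ x (x + z)) / (L : ℝ) ^ d := by
      rw [← sum_xyzStructureFactor_mul_cos_torusPhase, Finset.sum_div]
      exact sum_congr rfl fun q _ => by ring
    rw [h1]
    exact hrow z hz
  have hceil : ∀ q : TorusSite d L, q ≠ 0 → xyzStructureFactor L n J₁ J₂ q / (L : ℝ) ^ d ≤
      Real.sqrt (Xup q / (4 * dispersion (latticeMomentum L q))) / (L : ℝ) ^ d := by
    intro q hq
    have hE : 0 < dispersion (latticeMomentum L q) := dispersion_latticeMomentum_pos hq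
    refine div_le_div_of_nonneg_right ?_ hLd.le
    refine (xyzStructureFactor_le_sqrt_of_groundEnergy_le L n J₁ J₂ hL hd hGD q hq).trans ?_
    exact Real.sqrt_le_sqrt (div_le_div_of_nonneg_right (hX q hq) (by positivity))
  have h := lpDual_kernel_floor W (fun z q => Real.cos (torusPhase L q z)) c ε κ
    (fun q => xyzStructureFactor L n J₁ J₂ q / (L : ℝ) ^ d)
    (fun q => Real.sqrt (Xup q / (4 * dispersion (latticeMomentum L q))) / (L : ℝ) ^ d) 0 hS hrow' hceil
  simpa only [torusPhase_zero_left, Real.cos_zero, mul_one] using h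

/-- **The LP-dual bound, Gaussian domination discharged** (even side `L ≥ 4`, `0 ≤ J₁`, `J₂ ≤ 0`,
`d ≥ 1`, every spin): the inequality of `xyz_lpDual_floor_of_groundEnergy_le` holds. For the spin-½
easy-plane XXZ model of `xxz_ground_lro_spinHalf_window` take `n = 1`, `J₁ = 1`, `J₂ = -Δ`.
[cite: BjornbergUeltschi2022, Cor. 5.3, Lemma 4.4] [cite: KLS1988JSP, eqs. (6)-(11), p. 1021] -/
theorem xyz_lpDual_floor (hLe : Even L) (h4 : 4 ≤ L) (hd : 0 < d) (hJ₁ : 0 ≤ J₁) (hJ₂ : J₂ ≤ 0)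
    (W : Finset (TorusSite d L)) (κ c ε : TorusSite d L → ℝ) (Xup : TorusSite d L → ℝ)
    (hrow : ∀ z ∈ W,
      |(∑ x : TorusSite d L, xyzGroundCorr 0 L n J₁ J₂ x (x + z)) / (L : ℝ) ^ d - c z| ≤ ε z)
    (hX : ∀ q : TorusSite d L, q ≠ 0 →
      (∑ i, ((J₂ * xyzBondCorr (d := d) 1 L n J₁ J₂ + J₁ * xyzBondCorr (d := d) 2 L n J₁ J₂) -
          (J₁ * xyzBondCorr (d := d) 1 L n J₁ J₂ + J₂ * xyzBondCorr (d := d) 2 L n J₁ J₂) *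
            Real.cos (latticeMomentum L q i))) ≤ Xup q) :
    ∑ z ∈ W, (κ z * c z - |κ z| * ε z) -
        ∑ q ∈ (univ : Finset (TorusSite d L)).erase 0,
          max (∑ z ∈ W, κ z * Real.cos (torusPhase L q z)) 0 *
            (Real.sqrt (Xup q / (4 * dispersion (latticeMomentum L q))) / (L : ℝ) ^ d) ≤
      (∑ z ∈ W, κ z) * (xyzStructureFactor L n J₁ J₂ (0 : TorusSite d L) / (L : ℝ) ^ d) :=
  xyz_lpDual_floor_of_groundEnergy_le L n J₁ J₂ (by omega) hd
    (fun h => buSpinHalf_gaussianDomination L n hLe h4 hJ₁ hJ₂ h) W κ c ε Xup hrow hX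

end Dictionary

/-! ### Packaging: long-range order from an eventual dictionary certificate -/

section Certificate

variable (n : ℕ) {J₁ J₂ : ℝ}

/-- **Long-range order from an eventual LP-dual certificate** (`0 ≤ J₁`, `J₂ ≤ 0`, `d ≥ 1`, every spin).
If from some side on, on every even torus there are a window `W`, weights `κ`, certified windows
`(c, ε)` on the site-averaged correlations `L⁻ᵈ Σ_x G⁰(x,x+z)` (`z ∈ W`), certified uppers `X̄` on the
infrared numerators, a positive kernel mass `K(0) = Σ_{z∈W} κ_z > 0`, and the certificate inequality
`a · K(0) ≤ Σ_{z∈W}(κ_z c_z - |κ_z| ε_z) - L⁻ᵈ Σ_{q≠0} K(q)⁺ √(X̄_q/(4E_q))` with one `a > 0` independent of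
`L`, then the ground states have long-range order in the third direction,
`HasEvenTorusLRO (groundStateAxisCorrTorus · n J₁ J₂ 1)` — the conclusion shape of
`xxz_ground_lro_spinHalf_window` (`n = 1`, `J₁ = 1`, `J₂ = -Δ`). The `L`-uniform data are exactly what a
certified SDP window plus a trigonometric-polynomial majorant of the Riemann sum would supply; none is
asserted here. [cite: KLS1988JSP, eqs. (6)-(11), p. 1021] [cite: BjornbergUeltschi2022, Thm. 3.2, (4.31)-(4.32)] -/
theorem xyz_hasEvenTorusLRO_of_lpDual_certificate (hd : 0 < d) (hJ₁ : 0 ≤ J₁) (hJ₂ : J₂ ≤ 0) {a : ℝ}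
    (ha : 0 < a)
    (hcert : ∃ L₀ : ℕ, ∀ (L : ℕ) [NeZero L], Even L → L₀ ≤ L →
      ∃ (W : Finset (TorusSite d L)) (κ c ε Xup : TorusSite d L → ℝ),
        (∀ z ∈ W, |(∑ x : TorusSite d L, xyzGroundCorr 0 L n J₁ J₂ x (x + z)) / (L : ℝ) ^ d - c z| ≤ ε z) ∧
        (∀ q : TorusSite d L, q ≠ 0 →
          (∑ i, ((J₂ * xyzBondCorr (d := d) 1 L n J₁ J₂ + J₁ * xyzBondCorr (d := d) 2 L n J₁ J₂) -
              (J₁ * xyzBondCorr (d := d) 1 L n J₁ J₂ + J₂ * xyzBondCorr (d := d) 2 L n J₁ J₂) *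
                Real.cos (latticeMomentum L q i))) ≤ Xup q) ∧
        0 < ∑ z ∈ W, κ z ∧
        a * ∑ z ∈ W, κ z ≤ ∑ z ∈ W, (κ z * c z - |κ z| * ε z) -
          ∑ q ∈ (univ : Finset (TorusSite d L)).erase 0,
            max (∑ z ∈ W, κ z * Real.cos (torusPhase L q z)) 0 *
              (Real.sqrt (Xup q / (4 * dispersion (latticeMomentum L q))) / (L : ℝ) ^ d)) :
    HasEvenTorusLRO (fun L x y => groundStateAxisCorrTorus (d := d) L n J₁ J₂ 1 x y) := by
  obtain ⟨L₀, hL₀⟩ := hcert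
  rw [hasEvenTorusLRO_iff]
  have hev : ∀ᶠ k : ℕ in atTop, a ≤
      (∑ x ∈ halfOpenBox d (2 * k), ∑ y ∈ halfOpenBox d (2 * k),
          torusPullback (fun L x y => groundStateAxisCorrTorus (d := d) L n J₁ J₂ 1 x y) (2 * k) x y) /
        ((halfOpenBox d (2 * k)).card : ℝ) ^ 2 := by
    filter_upwards [eventually_ge_atTop (max L₀ 2)] with k hk
    have hk2 : 2 ≤ k := le_trans (le_max_right _ _) hk
    have hkL : L₀ ≤ 2 * k := by omega
    haveI : NeZero (2 * k) := ⟨by omega⟩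
    obtain ⟨W, κ, c, ε, Xup, hrow, hX, hK0, hle⟩ := hL₀ (2 * k) (even_two_mul k) hkL
    rw [xyz_lroSeq_eq n k (by omega) J₁ J₂]
    have h := xyz_lpDual_floor (2 * k) n J₁ J₂ (even_two_mul k) (by omega) hd hJ₁ hJ₂ W κ c ε Xup hrow hX
    by_contra hlt
    push Not at hlt
    have h' : (∑ z ∈ W, κ z) * (xyzStructureFactor (2 * k) n J₁ J₂ (0 : TorusSite d (2 * k)) /
        ((2 * k : ℕ) : ℝ) ^ d) < a * ∑ z ∈ W, κ z := by
      rw [mul_comm a]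
      exact mul_lt_mul_of_pos_left hlt hK0
    linarith
  exact lt_of_lt_of_le ha
    (le_liminf_of_le (isCoboundedUnder_ge_of_le atTop fun k => xyz_lroSeq_le n k J₁ J₂) hev)

end Certificate

end Literature.MathematicalPhysics.QuantumLattice
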